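import Summits.QuantumFields.BalabanUV.Beta.EriceFlowEnclosureB12AsPrintedPointwiseFadingRunRows

/-!
# Beta / EriceFlowEnclosureB12AsPrintedPointwiseFadingRunRowsWitness — part 12c: `0 < b⋆` IS LOAD-BEARING FOR THE DECIDING CRUX'S ROW (iv).
# The Markov family **`β_{k+1}(g_0,…,g_k) = −a·g_k`** (a > 0) carries EVERY letter of part 12's NE4 road except positivity: node U2's moduli (diagonal `Λ k i = a·[i = k]`, fading at
# any rate), NE4 at rate ZERO, part 11's asymptotic constant **`b⋆ = 0`** (`|betaInf β (u,u,…) − 0| ≤ a·u∕(1−θ)`), rows (i) and (C) at EVERY level — and yet at EVERY level `γ₀ > 0` its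
# run from the top of the box drives `1∕g_n²` to `+∞` (increments `a·g_n ≥ a∕√(1∕γ₀² + M)` as long as the window sum stays above `−M`), so **NO run-wise partial-sum floor `−M` holds at
# any level, for any M**: the hypothesis `0 < b⋆` of `rowsTriple_of_moduli_NE4_bstar_pos` ∕ `runRowsCont13_of_moduli_NE4_bstar_pos` cannot be weakened to `0 ≤ b⋆`, and K1⁸'s rows
# ∃-shape is NOT a consequence of the moduli + NE4 alone.
# (β-flow team, prover 2 = lower ∕ positivity side, unit `b2b-balaban-beta-bflow-p2`, gen 50; witness part of part 12)

HONEST FRAMING (page 1 of everything the β sub-cell writes): discharging `BetaPertH` makes Bałaban's UV stability UNCONDITIONAL — a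
real constructive-QFT result; it is NOT the continuum limit and NOT the Clay problem.  HONEST DEPENDENCY (cell reorg 2026-08-19,
verbatim): «continuum YM on T⁴ ⇐ BetaPertH ∧ nine spine estimates (0/9 proved); BetaPertH ⇐ (D1) ∧ (D4) ∧ CAP+tail; G-an2-4 gates
asym, D1 and NE2/3/4.»  THIS MODULE DISCHARGES NOTHING: one explicit TOY family (NOT Bałaban's β — its sign is the opposite of asymptotic freedom) checked against node U2's HYPOTHESIS
SHAPES `T4CouplingMatching.{LastOnlyLipschitz, HistLipschitz, FadingMemory, ScaleShiftRate}` (`histLipschitz_of_lastOnly`, `fadingMemory_diag` BY NAME), node U2's `T4BetaStationary.betaInf`,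
the telescoped (0.20) `FlowStep.inv_sq_telescopeH`, pub-balaban-gaps' `Gaps.EndRunwiseCone.runwisePS_of_betaPartialSumsLowerH` and part 12's §1–§2 rows BY NAME.  The toy is written as a
lambda (no `def`); its run is constructed inside the proofs.  Nothing is asserted about Bałaban's β-functions (1.22).

WHAT THIS FILE PROVES (0 sorry, 0 def): §1 `lastOnlyLipschitz_negLin`, `histLipschitz_negLin`, `scaleShiftRate_negLin`, `betaInf_negLin`, **`bstar_zero_negLin`** (part 11's property with
`b⋆ = 0`, `C = a`); §2 **`exists_run_negLin`** (at every level a solution of (0.20) in ]0, γ₀] of every depth from `g_0 = γ₀`, with `Σ_{j<n} β = 1∕γ₀² − 1∕g_n²`), **`no_runPS_negLin`** (∀ γ₀ > 0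
∀ M ∃ in-window run with window sum `< −M`), `not_betaPartialSumsLowerH_negLin`; §3 HEADLINE **`bstar_pos_loadBearing`** (∃ β Λ a: all letters of part 12's NE4 road with `b⋆ = 0`, rows (i)+(C)
at every level, and NO row (iv) at any level).
NOT CLAIMED: anything about Bałaban's β; that print's flow has `b⋆ = 0` (the typed Theorem 2 forces `b⋆ > 0`, part 11c); K1⁸; `BetaPertH`; continuum; Clay.
-/

namespace Summit.QuantumFields.BalabanUV.Beta.EriceFlowEnclosureB12AsPrintedPointwiseFadingRunRowsWitness

open Finset Filter Topology
open Literature.MathematicalPhysics.QuantumFieldTheory.Balaban1983to89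
open Literature.MathematicalPhysics.QuantumFieldTheory.Balaban1983to89.FlowStep (HBeta prefixOf Box mem_box RGEqH clampPrefix Y inv_sq_telescopeH)
open Literature.MathematicalPhysics.QuantumFieldTheory.Balaban1983to89.FlowStepRuns (BetaPartialSumsLowerH)
open Literature.MathematicalPhysics.QuantumFieldTheory.Balaban1983to89.T4CouplingMatching (HistLipschitz FadingMemory ScaleShiftRate LastOnlyLipschitz
  histLipschitz_of_lastOnly fadingMemory_diag)
open Literature.MathematicalPhysics.QuantumFieldTheory.Balaban1983to89.T4BetaStationary (revHist betaInf)
open Summit.QuantumFields.BalabanUV.Gaps.EndRunwiseCone (runwisePS_of_betaPartialSumsLowerH)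
open Summit.QuantumFields.BalabanUV.Beta.EriceFlowEnclosureB12AsPrintedPointwiseFadingRunRows (runRem_constHist_of_moduli survCont_of_moduli)

noncomputable section

/-! ## §1 The letters of part 12's NE4 road, all present, with `b⋆ = 0` -/

/-- The family `β_{k+1}(g_{≤k}) = −a·g_k` is last-only Lipschitz with constant `a` on every box (`0 ≤ a`). [folklore] -/
theorem lastOnlyLipschitz_negLin {a : ℝ} (ha : 0 ≤ a) (γ : ℝ) :
    LastOnlyLipschitz a γ (fun k (v : Fin (k + 1) → ℝ) => -a * v (Fin.last k)) := by
  intro k p q _ _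
  have : -a * p (Fin.last k) - -a * q (Fin.last k) = -a * (p (Fin.last k) - q (Fin.last k)) := by ring
  rw [this, abs_mul, abs_neg, abs_of_nonneg ha]

/-- … hence node U2's modulus with the DIAGONAL moduli `Λ k i = a·[i = k]` on every box (`histLipschitz_of_lastOnly` BY NAME); these fade at ANY rate θ ≥ 0 with constant `a`
(`fadingMemory_diag`). [folklore] -/
theorem histLipschitz_negLin {a : ℝ} (ha : 0 ≤ a) (γ : ℝ) :
    HistLipschitz (fun k i => if i = k then a else 0) γ (fun k (v : Fin (k + 1) → ℝ) => -a * v (Fin.last k)) :=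
  histLipschitz_of_lastOnly (lastOnlyLipschitz_negLin ha γ)

/-- NE4 at rate ZERO: a last-only family is its own scale shift (`Fin.tail` keeps the last entry). [folklore] -/
theorem scaleShiftRate_negLin (a θ γ : ℝ) :
    ScaleShiftRate 0 θ γ (fun k (v : Fin (k + 1) → ℝ) => -a * v (Fin.last k)) := by
  intro k w _
  have htail : Fin.tail w (Fin.last k) = w (Fin.last (k + 1)) := by
    rw [Fin.tail, Fin.succ_last]
  simp only [htail, sub_self, abs_zero, zero_mul, le_refl]

/-- node U2's stationary functional of this family on the constant history `(u, u, …)` is `−a·u` (the defining sequence is constant). [folklore] -/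
theorem betaInf_negLin (a u : ℝ) :
    betaInf (fun k (v : Fin (k + 1) → ℝ) => -a * v (Fin.last k)) (fun _ : ℕ => u) = -a * u := by
  unfold betaInf
  have h : (fun k : ℕ => (fun k (v : Fin (k + 1) → ℝ) => -a * v (Fin.last k)) k (revHist (fun _ : ℕ => u) k)) =
      fun _ : ℕ => -a * u := by
    funext k
    simp [revHist]
  rw [h]
  exact tendsto_const_nhds.limUnder_eq

/-- **PART 11's ASYMPTOTIC CONSTANT IS `b⋆ = 0`** for this family, on every box and at every rate `0 ≤ θ < 1`, with the moduli's constant `C = a`: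
`|betaInf β (u,u,…) − 0| = a·u ≤ a·u∕(1−θ)`. [folklore] -/
theorem bstar_zero_negLin {a θ : ℝ} (ha : 0 ≤ a) (hθ0 : 0 ≤ θ) (hθ1 : θ < 1) (γ : ℝ) :
    ∀ u : ℝ, 0 < u → u ≤ γ →
      |betaInf (fun k (v : Fin (k + 1) → ℝ) => -a * v (Fin.last k)) (fun _ : ℕ => u) - 0| ≤ a * u / (1 - θ) := by
  intro u hu _
  have h1θ : 0 < 1 - θ := by linarith
  rw [betaInf_negLin, sub_zero, neg_mul, abs_neg, abs_of_nonneg (mul_nonneg ha hu.le), le_div_iff₀ h1θ]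
  have : 0 ≤ a * u := mul_nonneg ha hu.le
  nlinarith

/-! ## §2 The run from the top of the box drives `1∕g²` to `+∞`: no run-wise partial-sum floor at any level -/

/-- **THE RUN FROM THE TOP OF THE BOX.**  For `a ≥ 0` and every level `γ₀ > 0` there is ONE coupling sequence `gs` with `gs 0 = γ₀` solving (0.20) for this family to EVERY depth and
staying in ]0, γ₀] (the couplings decrease), along which the window sums telescope: `Σ_{j<n} β_{j+1}(gs_{≤j}) = 1∕γ₀² − 1∕(gs n)²`, and `1∕(gs n)²` grows at least linearly as long as it
stays below a threshold: `1∕(gs n)² ≤ T` for all `n ≤ N` ⟹ `1∕γ₀² + N·a∕√T ≤ 1∕(gs N)²`. [cite: Balaban1987RG1, (0.20) p.256] -/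
theorem exists_run_negLin {a γ₀ : ℝ} (ha : 0 ≤ a) (hγ₀ : 0 < γ₀) :
    ∃ gs : ℕ → ℝ, gs 0 = γ₀ ∧ (∀ n, RGEqH n (fun k (v : Fin (k + 1) → ℝ) => -a * v (Fin.last k)) gs) ∧
      (∀ n, Step.InInterval γ₀ n gs) ∧
      (∀ n, ∑ j ∈ Ico 0 n, (fun k (v : Fin (k + 1) → ℝ) => -a * v (Fin.last k)) j (prefixOf gs j) = 1 / γ₀ ^ 2 - 1 / (gs n) ^ 2) ∧
      ∀ (T : ℝ) (N : ℕ), 0 < T → (∀ n, n ≤ N → 1 / (gs n) ^ 2 ≤ T) → 1 / γ₀ ^ 2 + N * (a / Real.sqrt T) ≤ 1 / (gs N) ^ 2 := by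
  -- the inverse squared couplings y, defined by y₀ = 1/γ₀², y_{j+1} = y_j + a/√y_j
  obtain ⟨y, hy0, hysucc⟩ : ∃ y : ℕ → ℝ, y 0 = 1 / γ₀ ^ 2 ∧ ∀ j, y (j + 1) = y j + a / Real.sqrt (y j) :=
    ⟨fun n => Nat.rec (1 / γ₀ ^ 2) (fun _ t => t + a / Real.sqrt t) n, rfl, fun _ => rfl⟩
  have hy0pos : 0 < y 0 := by rw [hy0]; positivity
  have hmono : ∀ j, y 0 ≤ y j ∧ 0 < y j := by
    intro j
    induction j with
    | zero => exact ⟨le_rfl, hy0pos⟩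
    | succ j ih =>
      have hinc : 0 ≤ a / Real.sqrt (y j) := div_nonneg ha (Real.sqrt_nonneg _)
      rw [hysucc]
      exact ⟨by linarith [ih.1], by linarith [ih.2]⟩
  set gs : ℕ → ℝ := fun j => 1 / Real.sqrt (y j) with hgs
  have hgspos : ∀ j, 0 < gs j := fun j => by
    simp only [hgs]; exact one_div_pos.mpr (Real.sqrt_pos.mpr (hmono j).2)
  have hinv : ∀ j, 1 / (gs j) ^ 2 = y j := by
    intro j
    simp only [hgs]
    rw [div_pow, one_pow, Real.sq_sqrt (hmono j).2.le, one_div_one_div]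
  have hsqrt0 : Real.sqrt (y 0) = 1 / γ₀ := by
    rw [hy0, show (1 : ℝ) / γ₀ ^ 2 = (1 / γ₀) ^ 2 by ring, Real.sqrt_sq (by positivity)]
  have hgs0 : gs 0 = γ₀ := by
    simp only [hgs]; rw [hsqrt0, one_div_one_div]
  refine ⟨gs, hgs0, ?_, ?_, ?_, ?_⟩
  · -- (0.20)
    intro n k _
    rw [hinv, hinv, hysucc]
    simp only [prefixOf, Fin.val_last, hgs]
    ring
  · -- the window ]0, γ₀]
    intro n j _
    refine ⟨hgspos j, ?_⟩
    have h1 : 1 / γ₀ ≤ Real.sqrt (y j) := by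
      rw [← hsqrt0]; exact Real.sqrt_le_sqrt (hmono j).1
    calc gs j = 1 / Real.sqrt (y j) := rfl
      _ ≤ 1 / (1 / γ₀) := one_div_le_one_div_of_le (by positivity) h1
      _ = γ₀ := one_div_one_div γ₀
  · -- telescoping
    intro n
    have hsum : ∀ m, ∑ j ∈ Ico 0 m, (fun k (v : Fin (k + 1) → ℝ) => -a * v (Fin.last k)) j (prefixOf gs j) = y 0 - y m := by
      intro m
      induction m with
      | zero => simp
      | succ m ih =>
        rw [sum_Ico_succ_top (Nat.zero_le m), ih, hysucc]
        simp only [prefixOf, Fin.val_last, hgs]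
        ring
    rw [hsum, hy0, hinv]
  · -- linear growth below a threshold
    intro T N hT hle
    have hstep : ∀ n, n < N → y n + a / Real.sqrt T ≤ y (n + 1) := by
      intro n hn
      have hyn : y n ≤ T := by rw [← hinv]; exact hle n hn.le
      have hsq : Real.sqrt (y n) ≤ Real.sqrt T := Real.sqrt_le_sqrt hyn
      have hsqpos : 0 < Real.sqrt (y n) := Real.sqrt_pos.mpr (hmono n).2
      have hdiv : a / Real.sqrt T ≤ a / Real.sqrt (y n) := div_le_div_of_nonneg_left ha hsqpos hsq
      rw [hysucc]; linarith
    have hind : ∀ n, n ≤ N → y 0 + n * (a / Real.sqrt T) ≤ y n := by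
      intro n
      induction n with
      | zero => intro _; simp
      | succ n ih =>
        intro hn
        have h1 := ih (Nat.le_of_succ_le hn)
        have h2 := hstep n (Nat.lt_of_succ_le hn)
        push_cast
        linarith
    rw [← hy0, hinv]
    exact hind N le_rfl

/-- **NO RUN-WISE PARTIAL-SUM FLOOR AT ANY LEVEL.**  For `a > 0`, every level `γ₀ > 0` and every `M` there is an in-window solution of (0.20) (the run from the top of the box, to a
suitable depth) whose full window sum is `< −M` — row (iv) of K1⁸'s shape FAILS for this family at every level, although the moduli, NE4 and part 11's constant `b⋆ = 0` are all present.
[cite: Balaban1987RG1, (0.20) p.256 and Thm 2 p.259] -/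
theorem no_runPS_negLin {a γ₀ : ℝ} (ha : 0 < a) (hγ₀ : 0 < γ₀) (M : ℝ) :
    ∃ (n : ℕ) (gs : ℕ → ℝ), RGEqH n (fun k (v : Fin (k + 1) → ℝ) => -a * v (Fin.last k)) gs ∧ Step.InInterval γ₀ n gs ∧
      ∑ j ∈ Ico 0 n, (fun k (v : Fin (k + 1) → ℝ) => -a * v (Fin.last k)) j (prefixOf gs j) < -M := by
  obtain ⟨gs, _, hrg, hI, htel, hgrow⟩ := exists_run_negLin ha.le hγ₀
  by_contra hcon
  push Not at hcon
  -- along the top run every window sum is ≥ −M, so 1/(gs n)² ≤ 1/γ₀² + M for all n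
  have hbound : ∀ n, 1 / (gs n) ^ 2 ≤ 1 / γ₀ ^ 2 + M := by
    intro n
    have h := hcon n gs (hrg n) (hI n)
    rw [htel n] at h
    linarith
  have hT : 0 < 1 / γ₀ ^ 2 + M := by
    have h0 := hbound 0
    have : 0 < 1 / (gs 0) ^ 2 := by have := (hI 0 0 le_rfl).1; positivity
    linarith
  set d : ℝ := a / Real.sqrt (1 / γ₀ ^ 2 + M) with hd
  have hdpos : 0 < d := div_pos ha (Real.sqrt_pos.mpr hT)
  -- pick N with N·d > M; linear growth contradicts the bound
  obtain ⟨N, hN⟩ := exists_nat_gt (M / d)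
  have hNd : M < N * d := by rwa [div_lt_iff₀ hdpos] at hN
  have hg := hgrow (1 / γ₀ ^ 2 + M) N hT fun n _ => hbound n
  have hb := hbound N
  linarith

/-- … in particular the END-grade carrier fails at every level: `¬ BetaPartialSumsLowerH M γ₀ β` for every M (pub-balaban-gaps' `runwisePS_of_betaPartialSumsLowerH` would give the
run-wise floor). [folklore] -/
theorem not_betaPartialSumsLowerH_negLin {a γ₀ : ℝ} (ha : 0 < a) (hγ₀ : 0 < γ₀) (M : ℝ) :
    ¬ BetaPartialSumsLowerH M γ₀ (fun k (v : Fin (k + 1) → ℝ) => -a * v (Fin.last k)) := by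
  intro hps
  obtain ⟨n, gs, hrg, hI, hlt⟩ := no_runPS_negLin ha hγ₀ M
  have h := runwisePS_of_betaPartialSumsLowerH hγ₀ hps n gs hrg hI 0 (Nat.zero_le n)
  linarith

/-! ## §3 Headline: `0 < b⋆` is load-bearing for row (iv) -/

/-- **`0 < b⋆` IS LOAD-BEARING IN PART 12's NE4 ROAD.**  There is a family `β` (namely `β_{k+1}(g_{≤k}) = −a·g_k`, a = 1) with history moduli `Λ` and a constant `a > 0` such that:
node U2's modulus holds on EVERY box, the moduli fade at EVERY rate `θ ≥ 0` with constant `a`, NE4 holds at rate ZERO on every box, part 11's asymptotic-constant property holds with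
**`b⋆ = 0`** (constant `C = a`) at every rate `0 ≤ θ < 1` on every box, rows (i) (with the constant-history remainder sequence, radius `aγ₀∕(1−θ)`) and (C) hold at EVERY level — and row
(iv) FAILS at EVERY level for EVERY `M`.  So in `rowsTriple_of_moduli_NE4_bstar_pos` (and the YangMills-side `runRowsCont13_of_moduli_NE4_bstar_pos`) the hypothesis `0 < b⋆` cannot be
weakened to `0 ≤ b⋆`: K1⁸'s rows ∃-shape is NOT a consequence of the moduli + NE4 alone. [folklore] -/
theorem bstar_pos_loadBearing :
    ∃ (β : HBeta) (Λ : ℕ → ℕ → ℝ) (a : ℝ), 0 < a ∧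
      (∀ γ : ℝ, HistLipschitz Λ γ β) ∧ (∀ θ : ℝ, 0 ≤ θ → FadingMemory a θ Λ) ∧ (∀ θ γ : ℝ, ScaleShiftRate 0 θ γ β) ∧
      (∀ θ γ : ℝ, 0 ≤ θ → θ < 1 → ∀ u : ℝ, 0 < u → u ≤ γ → |betaInf β (fun _ : ℕ => u) - 0| ≤ a * u / (1 - θ)) ∧
      (∀ θ γ₀ : ℝ, 0 ≤ θ → θ < 1 → 0 < γ₀ →
        (∀ (n : ℕ) (gs : ℕ → ℝ), RGEqH n β gs → Step.InInterval γ₀ n gs →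
            ∀ k, k ≤ n → |β k (prefixOf gs k) - β k (fun _ : Fin (k + 1) => γ₀)| ≤ a * γ₀ / (1 - θ)) ∧
          ∀ k : ℕ, ContinuousOn (fun x : ℝ => β k (clampPrefix β γ₀ k x))
            {x : ℝ | 0 < x ∧ x ≤ γ₀ ∧ ∀ j, j ≤ k → 1 / γ₀ ^ 2 ≤ Y β γ₀ j x}) ∧
      ∀ γ₀ : ℝ, 0 < γ₀ → ∀ M : ℝ, ∃ (n : ℕ) (gs : ℕ → ℝ), RGEqH n β gs ∧ Step.InInterval γ₀ n gs ∧
        ∑ j ∈ Ico 0 n, β j (prefixOf gs j) < -M := by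
  refine ⟨fun k (v : Fin (k + 1) → ℝ) => -1 * v (Fin.last k), fun k i => if i = k then (1 : ℝ) else 0, 1, one_pos,
    fun γ => histLipschitz_negLin zero_le_one γ, fun θ hθ => fadingMemory_diag zero_le_one hθ, fun θ γ => scaleShiftRate_negLin 1 θ γ,
    fun θ γ hθ0 hθ1 => bstar_zero_negLin zero_le_one hθ0 hθ1 γ, fun θ γ₀ hθ0 hθ1 hγ₀ => ⟨?_, ?_⟩,
    fun γ₀ hγ₀ M => no_runPS_negLin one_pos hγ₀ M⟩
  · exact runRem_constHist_of_moduli (histLipschitz_negLin zero_le_one γ₀) (fadingMemory_diag zero_le_one hθ0) hθ0 hθ1 zero_le_one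
      hγ₀ le_rfl
  · exact survCont_of_moduli (histLipschitz_negLin zero_le_one γ₀) hγ₀ le_rfl

end

end Summit.QuantumFields.BalabanUV.Beta.EriceFlowEnclosureB12AsPrintedPointwiseFadingRunRowsWitness
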